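import Literature.Analysis.FluidPDE.PeriodicCellRestriction
import Literature.Analysis.FluidPDE.TorusLatticeNorms
import Literature.Analysis.FluidPDE.PeriodicCylinderConvectionCalculus
import Literature.Analysis.FluidPDE.PeriodicCylinderWordNorms
import HarnessLib

/-!
# The torus representative of a smooth periodic field on the closed cylinder

Analysis/FluidPDE support file for the energy-method construction of Euler flows in the
periodic cylinder (`Literature.Analysis.FluidPDE.KatoLai1984_periodicCylinderUniformExistence`;
Kato–Lai 1984, §7 (7.1): extension `R` to the whole space / restriction `R'`, `R'R = 1`). For a
field `w` smooth on the closed cylinder `{r ≤ 1}` and `L`-periodic in `z`, the **torus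
representative** `torusRep L w = toTorus L (cylExtend w)` (radial Seeley extension, read on the flat
torus `T³` through the period box) is smooth, and:

* `fromTorus_torusRep_of_mem_K` — `fromTorus L (torusRep L w) = w` on the closed cylinder
  (so `R'R = 1` there), `eqOn_cylinderCell_fromTorus_torusRep`;
* `cylDeriv_cylBasis_eq_fromTorus` — on the open cylinder the coordinate derivatives are read off
  the torus: `∂ᵢ w = aᵢ⁻¹ · fromTorus L (∂ᵢ (torusRep L w))`, `a = (4, 4, L)`;
* `gradSqTrace_eq_fromTorus`, `norm_horizontalProj_sq_eq_fromTorus` — the two quadratic forms of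
  the pressure Neumann problem (`∑ᵢⱼ (∂ᵢw)ⱼ(∂ⱼw)ᵢ` and `|w_h|²`) are `fromTorus` of explicit torus
  scalars `torusGradSqTrace`, `torusHorizSq`;
* `eSobolevDomainNorm_lt_top_of_isSmoothPeriodic` — the cell Sobolev norms of `w` are finite;
* `exists_latNormSq_torusRep_le` — **the lattice energies of the representative by the cell
  Sobolev norms**: `latNormSq p (torusRep L w) ≤ C ‖w‖²_{W^{p,2}(cell)}` (`PeriodicCellTransfer`).

Everything is proved; no named fact and no `sorry` is introduced.

## Mathlib / tree search

Tree: `PeriodicCylinder.toTorus`, `fromTorus`, `fromTorus_toTorus_apply`, `iterDirDeriv_fromTorus`,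
`cylExtend_of_le_one`, `exists_latticeEnergy_toTorus_cylExtend_le`,
`exists_cellEnergy_le_eSobolevDomainNorm_sq` (`PeriodicBoxTorus`, `PeriodicCylinderExtension`,
`PeriodicCellTransfer`); `cylDeriv_eq_fderiv`, `closure_unitCylinder`, `gradSqTrace`
(`PeriodicCylinderWithinCalculus`, `PeriodicCylinderConvectionCalculus`);
`cylWord_constWord_eqOn_iterDeriv'`, `contDiffOn_cylWord_jcWord`, `memLp_two_cylinderCell_of_continuousOn`
(`PeriodicCylinderWordNorms`).

## References

* T. Kato, C. Y. Lai, J. Funct. Anal. 56 (1984) 15–28, §7 (7.1). [KatoLai1984]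
-/

noncomputable section

open MeasureTheory Set Function Filter Topology TopologicalSpace WithLp Finset
open scoped ContDiff NNReal ENNReal InnerProductSpace RealInnerProductSpace

namespace Literature.Analysis.FluidPDE

open FunctionSpaces FunctionSpaces.Torus UnitAddTorus

/-- Local notation for physical space `ℝ³ = EuclideanSpace ℝ (Fin 3)`. -/
local notation "ℝ³" => EuclideanSpace ℝ (Fin 3)

/-- Local notation for the closed cylinder `{r ≤ 1}`. -/
local notation "𝕂" => closure (SetLike.coe unitCylinder : Set (EuclideanSpace ℝ (Fin 3)))

namespace PeriodicCylinder

variable {L : ℝ} {F : Type*} [NormedAddCommGroup F] [NormedSpace ℝ F]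

/-! ### The representative -/

/-- **The torus representative** `toTorus L (cylExtend w)` of a field on the closed cylinder. [folklore] -/
def torusRep (L : ℝ) (w : ℝ³ → F) : UnitAddTorus (Fin 3) → F := toTorus L (cylExtend w)

/-- The representative of a smooth periodic field is smooth. [folklore] -/
theorem isSmooth_torusRep [CompleteSpace F] {w : ℝ³ → F} (hw : IsSmoothPeriodic L w) : IsSmooth (torusRep L w) :=
  isSmooth_toTorus (contDiff_cylExtend hw.smooth) (isAxiallyPeriodic_cylExtend hw.periodic) (vanishesOffCore_cylExtend w)

/-- The representative is linear: sums. [folklore] -/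
theorem torusRep_add (L : ℝ) (w w' : ℝ³ → F) : torusRep L (w + w') = torusRep L w + torusRep L w' := by
  rw [torusRep, cylExtend_add, toTorus_add]; rfl

/-- The representative is linear: scalar multiples. [folklore] -/
theorem torusRep_smul (L : ℝ) (c : ℝ) (w : ℝ³ → F) : torusRep L (c • w) = c • torusRep L w := by
  rw [torusRep, cylExtend_smul, toTorus_smul]; rfl

/-- Points of the closed cylinder have `|x₀|, |x₁| ≤ 1`. [folklore] -/
theorem abs_apply_le_one_of_mem_K {x : ℝ³} (hx : x ∈ 𝕂) {i : Fin 3} (hi : i = 0 ∨ i = 1) : |x i| ≤ 1 := by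
  rw [closure_unitCylinder] at hx
  exact (abs_apply_le_cylRadius x hi).trans hx

/-- **`fromTorus L (torusRep L w) = w` on the closed cylinder** (`L > 0`, `w` periodic). [folklore] -/
theorem fromTorus_torusRep_of_mem_K (hL : 0 < L) {w : ℝ³ → F} (hw : IsAxiallyPeriodic L w) {x : ℝ³} (hx : x ∈ 𝕂) :
    fromTorus L (torusRep L w) x = w x := by
  have h0 := abs_apply_le_one_of_mem_K hx (Or.inl rfl)
  have h1 := abs_apply_le_one_of_mem_K hx (Or.inr rfl)
  rw [abs_le] at h0 h1
  rw [torusRep, fromTorus_toTorus_apply hL (isAxiallyPeriodic_cylExtend hw) ⟨by linarith [h0.1], by linarith [h0.2]⟩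
    ⟨by linarith [h1.1], by linarith [h1.2]⟩]
  rw [closure_unitCylinder] at hx
  exact cylExtend_of_le_one hx

/-- On the open cell `w` is the restriction of its representative. [folklore] -/
theorem eqOn_cylinderCell_fromTorus_torusRep (hL : 0 < L) {w : ℝ³ → F} (hw : IsAxiallyPeriodic L w) :
    EqOn (fromTorus L (torusRep L w)) w (cylinderCell L : Set ℝ³) := fun _ hx =>
  fromTorus_torusRep_of_mem_K hL hw (subset_closure (cylinderCell_le_unitCylinder L hx))

/-- On the open cylinder `w` agrees with `fromTorus L (torusRep L w)` near every point. [folklore] -/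
theorem eventuallyEq_fromTorus_torusRep (hL : 0 < L) {w : ℝ³ → F} (hw : IsAxiallyPeriodic L w) {x : ℝ³}
    (hx : x ∈ (unitCylinder : Set ℝ³)) : w =ᶠ[𝓝 x] fromTorus L (torusRep L w) := by
  filter_upwards [unitCylinder.isOpen.mem_nhds hx] with y hy
  exact (fromTorus_torusRep_of_mem_K hL hw (subset_closure hy)).symm

/-! ### Derivatives on the open cylinder -/

/-- **Coordinate derivatives read off the torus**: on the open cylinder
`∂ᵢ w = aᵢ⁻¹ · fromTorus L (∂ᵢ (torusRep L w))`. [folklore] -/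
theorem cylDeriv_cylBasis_eq_fromTorus [CompleteSpace F] (hL : 0 < L) {w : ℝ³ → F} (hw : IsSmoothPeriodic L w)
    {x : ℝ³} (hx : x ∈ (unitCylinder : Set ℝ³)) (i : Fin 3) :
    cylDeriv (fun _ => cylBasis i) w x = (boxSide L i)⁻¹ • fromTorus L (Torus.wordDeriv [i] (torusRep L w)) x := by
  rw [cylDeriv_eq_fderiv _ _ hx, (eventuallyEq_fromTorus_torusRep hL hw.periodic hx).fderiv_eq]
  have h := congr_fun (iterDirDeriv_fromTorus hL.ne' (isSmooth_torusRep hw) [i]) x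
  simp only [Torus.wordVecs_cons, Torus.wordVecs_nil, iterDirDeriv_cons, iterDirDeriv_nil, boxScale_cons, boxScale_nil,
    mul_one] at h
  exact h

/-! ### The two quadratic forms of the pressure problem -/

/-- The torus scalar behind `∑ᵢⱼ (∂ᵢw)ⱼ (∂ⱼw)ᵢ`: `∑ᵢⱼ aᵢ⁻¹ aⱼ⁻¹ (∂ᵢW)ⱼ (∂ⱼW)ᵢ`. [folklore] -/
def torusGradSqTrace (L : ℝ) (W : UnitAddTorus (Fin 3) → ℝ³) (ξ : UnitAddTorus (Fin 3)) : ℝ :=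
  ∑ i, ∑ j, (boxSide L i)⁻¹ * (boxSide L j)⁻¹ * ((Torus.wordDeriv [i] W ξ) j * (Torus.wordDeriv [j] W ξ) i)

/-- **`∑ᵢⱼ (∂ᵢw)ⱼ (∂ⱼw)ᵢ = fromTorus L (torusGradSqTrace L (torusRep L w))` on the open cylinder.**
[folklore] -/
theorem gradSqTrace_eq_fromTorus (hL : 0 < L) {w : ℝ³ → ℝ³} (hw : IsSmoothPeriodic L w) {x : ℝ³}
    (hx : x ∈ (unitCylinder : Set ℝ³)) :
    gradSqTrace w x = fromTorus L (torusGradSqTrace L (torusRep L w)) x := by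
  unfold gradSqTrace torusGradSqTrace
  simp only [cylDeriv_cylBasis_eq_fromTorus hL hw hx, PiLp.smul_apply, smul_eq_mul]
  show _ = ∑ i, ∑ j, (boxSide L i)⁻¹ * (boxSide L j)⁻¹ *
    ((Torus.wordDeriv [i] (torusRep L w) (proj (boxInv L x))) j * (Torus.wordDeriv [j] (torusRep L w) (proj (boxInv L x))) i)
  refine Finset.sum_congr rfl fun i _ => Finset.sum_congr rfl fun j _ => ?_
  simp only [fromTorus, lift_apply]
  ring

/-- The torus scalar behind `|w_h|²`. [folklore] -/
def torusHorizSq (W : UnitAddTorus (Fin 3) → ℝ³) (ξ : UnitAddTorus (Fin 3)) : ℝ := ‖horizontalProj (W ξ)‖ ^ 2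

/-- **`|w_h|² = fromTorus L (torusHorizSq (torusRep L w))` on the closed cylinder.** [folklore] -/
theorem norm_horizontalProj_sq_eq_fromTorus (hL : 0 < L) {w : ℝ³ → ℝ³} (hw : IsAxiallyPeriodic L w) {x : ℝ³}
    (hx : x ∈ 𝕂) : ‖horizontalProj (w x)‖ ^ 2 = fromTorus L (torusHorizSq (torusRep L w)) x := by
  rw [← fromTorus_torusRep_of_mem_K hL hw hx]
  rfl

/-! ### Finiteness of the cell Sobolev norms -/

/-- **The cell Sobolev norms of a smooth periodic field are finite.** [folklore] -/
theorem eSobolevDomainNorm_lt_top_of_isSmoothPeriodic [CompleteSpace F] (L : ℝ) (n : ℕ) {w : ℝ³ → F}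
    (hw : ContDiffOn ℝ ∞ w 𝕂) : eSobolevDomainNorm n 2 (cylinderCell L) volume w < ⊤ := by
  have hΩU : (cylinderCell L : Set ℝ³) ⊆ (unitCylinder : Set ℝ³) := cylinderCell_le_unitCylinder L
  have hfΩ : ContDiffOn ℝ ∞ w (cylinderCell L : Set ℝ³) :=
    hw.mono (subset_closure.trans (closure_cylinderCell_subset L))
  rw [eSobolevDomainNorm_eq_sum_iterDeriv 2 n hfΩ]
  refine ENNReal.sum_lt_top.2 fun m _ => ENNReal.sum_lt_top.2 fun w' _ => ?_
  rw [← eLpNorm_congr_ae (ae_restrict_of_forall_mem (cylinderCell L).isOpen.measurableSet fun x hx =>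
    cylWord_constWord_eqOn_iterDeriv' m _ w (hΩU hx))]
  exact (memLp_two_cylinderCell_of_continuousOn L (contDiffOn_cylWord_jcWord _ hw).continuousOn).eLpNorm_lt_top

/-! ### Lattice energies of the representative -/

/-- **The lattice energies of the representative by the cell Sobolev norms**:
`latNormSq p (torusRep L w) ≤ C ‖w‖²_{W^{p,2}(cell)}` for smooth periodic real fields. [folklore] -/
theorem exists_latNormSq_torusRep_le (hL : 0 < L) (p : ℕ) : ∃ C : ℝ, 0 ≤ C ∧
    ∀ (w : ℝ³ → ℝ³), IsSmoothPeriodic L w →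
      Torus.latNormSq p (torusRep L w) ≤ C * (eSobolevDomainNorm p 2 (cylinderCell L) volume w).toReal ^ 2 := by
  obtain ⟨C₁, hC₁0, hC₁⟩ := exists_latticeEnergy_toTorus_cylExtend_le hL p
  obtain ⟨C₂, hC₂0, hC₂⟩ := exists_cellEnergy_le_eSobolevDomainNorm_sq (F := ℝ³) p
  refine ⟨C₁ * C₂, by positivity, fun w hw => ?_⟩
  have hcell : ContDiffOn ℝ ∞ w (cylinderCell L : Set ℝ³) :=
    hw.smooth.mono (subset_closure.trans (closure_cylinderCell_subset L))
  have h1 := hC₁ w hw.smooth hw.periodic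
  have h2 := hC₂ L w hcell
  have hfin : eSobolevDomainNorm p 2 (cylinderCell L) volume w < ⊤ := eSobolevDomainNorm_lt_top_of_isSmoothPeriodic L p hw.smooth
  set E := eSobolevDomainNorm p 2 (cylinderCell L) volume w with hE
  have hE' : E = ENNReal.ofReal E.toReal := (ENNReal.ofReal_toReal hfin.ne).symm
  have hlat0 := Torus.latNormSq_nonneg p (torusRep L w)
  have key : ENNReal.ofReal (Torus.latNormSq p (torusRep L w)) ≤ ENNReal.ofReal (C₁ * C₂ * E.toReal ^ 2) := by
    calc ENNReal.ofReal (Torus.latNormSq p (torusRep L w)) ≤ ENNReal.ofReal C₁ * cellEnergy L p w := h1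
      _ ≤ ENNReal.ofReal C₁ * (ENNReal.ofReal C₂ * E ^ 2) := mul_le_mul_of_nonneg_left h2 bot_le
      _ = ENNReal.ofReal (C₁ * C₂ * E.toReal ^ 2) := by
          rw [hE', ENNReal.toReal_ofReal ENNReal.toReal_nonneg, ← ENNReal.ofReal_pow ENNReal.toReal_nonneg,
            ← ENNReal.ofReal_mul hC₂0, ← ENNReal.ofReal_mul hC₁0, mul_assoc]
  exact (ENNReal.ofReal_le_ofReal_iff (by positivity)).1 key

end PeriodicCylinder

end Literature.Analysis.FluidPDE
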